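import Mathlib
import HarnessLib

/-!
# `OneBodyCompleteness` · line `registered`, stub 5b `stub_windowPassage`:
# dominated Euler-window passage, robust to Bochner junk

Support file for the crux item stmt-AtomisticToContinuum-9583 (`OneBodyCompleteness`, route
`MourreKoopmanCharges` of `AtomisticToContinuum/HydrodynamicLimit`), proving the registered stub
`stub_windowPassage` of the skeleton `Cruxes/OneBodyCompleteness/Lines/birth.lean`.

Pure real analysis. If real functions `f N` are uniformly bounded (`|f N s| ≤ M` for all `N, s`) and
converge pointwise at EVERY `s` to a continuous `g`, then for every window `S > 0` and every `ε > 0`,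
eventually in `N`,
`|S⁻¹ ∫₀^S f N| ≤ |S⁻¹ ∫₀^S g| + ε`.

Nothing is assumed about the measurability of `s ↦ f N s`; the statement is robust to the Bochner
junk value: for an `N` at which `f N` is not interval integrable on `0..S`, Lean's
`∫ s in 0..S, f N s` is `0` (`intervalIntegral.integral_undef`) and the inequality is trivial. For the
other `N` it is Lebesgue's dominated convergence theorem
(`intervalIntegral.tendsto_integral_filter_of_dominated_convergence`) applied to the modified sequence
`F N := if IntervalIntegrable (f N) volume 0 S then f N else g`, which is interval integrable for every
`N`, bounded by the constant `M` (note `|g s| ≤ M` as a pointwise limit), and still converges to `g`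
pointwise.

References: folklore (Lebesgue dominated convergence on a bounded interval).
-/

namespace Summit.AtomisticToContinuum.HydrodynamicLimit.Theorems.MourreKoopmanChargesOneBodyCompleteness

open Filter MeasureTheory Topology Set
open scoped Topology

/-- **Elementary Cesàro-window estimate.** If `|a - b| < ε * S` with `0 < S`, then
`|S⁻¹ * a| ≤ |S⁻¹ * b| + ε`. [folklore] -/
theorem abs_inv_mul_le_of_abs_sub_lt {a b S ε : ℝ} (hS : 0 < S) (h : |a - b| < ε * S) :
    |S⁻¹ * a| ≤ |S⁻¹ * b| + ε := by
  have hSinv : 0 < S⁻¹ := inv_pos.2 hS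
  have hab : |a| ≤ |b| + ε * S := by
    have := abs_sub_abs_le_abs_sub a b
    linarith
  have hεS : S⁻¹ * (ε * S) = ε := by
    field_simp
  rw [abs_mul, abs_mul, abs_of_pos hSinv]
  calc S⁻¹ * |a| ≤ S⁻¹ * (|b| + ε * S) := mul_le_mul_of_nonneg_left hab hSinv.le
    _ = S⁻¹ * |b| + ε := by rw [mul_add, hεS]

/-- stub 5b — **DOMINATED EULER-WINDOW PASSAGE** (pure real analysis, robust to Bochner junk): if the
real functions `f N` are uniformly bounded and converge pointwise (every `s`) to a continuous `g`,
then for every window `S > 0` and `ε > 0`, eventually `|S⁻¹∫₀^S f N| ≤ |S⁻¹∫₀^S g| + ε` (for the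
`N` at which `f N` is interval integrable this is dominated convergence applied to
`F N := if IntervalIntegrable (f N) volume 0 S then f N else g`; for the others the interval integral
is the junk value `0`). [folklore] -/
theorem stub_windowPassage :
    ∀ (f : ℕ → ℝ → ℝ) (g : ℝ → ℝ) (M : ℝ), Continuous g → (∀ N s, |f N s| ≤ M) →
      (∀ s, Tendsto (fun N => f N s) atTop (𝓝 (g s))) →
      ∀ S : ℝ, 0 < S → ∀ ε : ℝ, 0 < ε →
        ∀ᶠ N : ℕ in atTop, |S⁻¹ * ∫ s in (0 : ℝ)..S, f N s| ≤ |S⁻¹ * ∫ s in (0 : ℝ)..S, g s| + ε := by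
  intro f g M hg hbound hlim S hS ε hε
  classical
  -- the pointwise limit inherits the uniform bound
  have hgM : ∀ s, |g s| ≤ M := fun s => le_of_tendsto' (hlim s).abs fun N => hbound N s
  -- the modified sequence: `f N` where it is interval integrable, `g` otherwise
  obtain ⟨F, hF⟩ : ∃ F : ℕ → ℝ → ℝ,
      F = fun N => if IntervalIntegrable (f N) volume 0 S then f N else g := ⟨_, rfl⟩
  have hF_pos : ∀ N, IntervalIntegrable (f N) volume 0 S → F N = f N := fun N h => by
    simp only [hF, if_pos h]
  have hF_neg : ∀ N, ¬ IntervalIntegrable (f N) volume 0 S → F N = g := fun N h => by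
    simp only [hF, if_neg h]
  have hFint : ∀ N, IntervalIntegrable (F N) volume 0 S := fun N => by
    by_cases h : IntervalIntegrable (f N) volume 0 S
    · rw [hF_pos N h]; exact h
    · rw [hF_neg N h]; exact hg.intervalIntegrable 0 S
  have hFbound : ∀ N s, |F N s| ≤ M := fun N s => by
    by_cases h : IntervalIntegrable (f N) volume 0 S
    · rw [hF_pos N h]; exact hbound N s
    · rw [hF_neg N h]; exact hgM s
  have hFlim : ∀ s, Tendsto (fun N => F N s) atTop (𝓝 (g s)) := fun s => by
    rw [Metric.tendsto_atTop]
    intro δ hδ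
    obtain ⟨N₀, hN₀⟩ := Metric.tendsto_atTop.1 (hlim s) δ hδ
    refine ⟨N₀, fun N hN => ?_⟩
    by_cases h : IntervalIntegrable (f N) volume 0 S
    · rw [hF_pos N h]; exact hN₀ N hN
    · rw [hF_neg N h, dist_self]; exact hδ
  -- dominated convergence for the modified sequence
  have hT : Tendsto (fun N => ∫ s in (0 : ℝ)..S, F N s) atTop (𝓝 (∫ s in (0 : ℝ)..S, g s)) := by
    refine intervalIntegral.tendsto_integral_filter_of_dominated_convergence (fun _ => M) ?_ ?_ ?_ ?_
    · exact Eventually.of_forall fun N => (hFint N).def'.aestronglyMeasurable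
    · exact Eventually.of_forall fun N => ae_of_all _ fun s _ => by
        rw [Real.norm_eq_abs]
        exact hFbound N s
    · exact intervalIntegrable_const
    · exact ae_of_all _ fun s _ => hFlim s
  have hev : ∀ᶠ N : ℕ in atTop,
      dist (∫ s in (0 : ℝ)..S, F N s) (∫ s in (0 : ℝ)..S, g s) < ε * S :=
    Metric.tendsto_nhds.1 hT (ε * S) (mul_pos hε hS)
  filter_upwards [hev] with N hN
  by_cases h : IntervalIntegrable (f N) volume 0 S
  · -- genuine integral: dominated convergence
    rw [← hF_pos N h]
    rw [Real.dist_eq] at hN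
    exact abs_inv_mul_le_of_abs_sub_lt hS hN
  · -- Bochner junk: the interval integral vanishes
    rw [intervalIntegral.integral_undef h, mul_zero, abs_zero]
    positivity

end Summit.AtomisticToContinuum.HydrodynamicLimit.Theorems.MourreKoopmanChargesOneBodyCompleteness
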